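import Summits.HodgeConjecture.CorCM.Census.QuaternionColumnBiarc

/-!
# The quaternion column, II: the biarc circle closes with exponent one — `2·[barc p q]` lies in the target lattice of the biarc faces

COR-CM (cell `pub-hodgecm2`), count-neutral kernel combinatorics by the binder seat b09 (gen 39; lane QUATERNION COLUMN), part II, on
part I `Census/QuaternionColumnBiarc.lean` (`barc`, `fplus`, `rt_a_barc`, `rt_c_barc`, `barc_add_n_eq_rt`, `xa_mul_xa_self`, `mapDomain_rt_a_fplus`), `BlockParity.mapDomain_rt_gface` / `oflipCM_cmul` / `oflipCM_oflipCM_comm` and the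
ORDER-FOUR TRICK of part J `Census/ResidualReductionTools.lean` (`Nondegenerate.two_mul_smul_single_mem_of_smul_add_mem`) used BY NAME.
Theorems only: no definition, no `decide`, no certificate, no named fact, no `sorry`.
HONEST FRAMING: `HC_CM` is NOT proved, here or anywhere in the tree; nothing here is a period or a headline.

WHY (numerics `HOME/pub-hodgecm2-b09/lean-g39/py2/qelim.py`, `qbiarc.py`).  For `Q_{4n}`, `n = 8`, the closing of the splitting method
(`Census/NondegenerateSplitting.lean`) CANNOT be done with faces whose corners stay within potential `3` of the base block of `T₀ = barc 0 0`
(rank deficit `16 = |R|`: the block of `T₀^{(a 0)}` never isolates); it must travel once around the **biarc circle** — the `n` blocks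
`BA_s = {barc p q : p − q ≡ s (mod n)}` (potential `|s|`, up to `n/2`).  The `n` orbits of biarc faces `fplus p q` ALONE generate, on the
`n − 1` non-base biarc blocks, a lattice of index `2^{n−1}` containing `2·e_s` for every `s` (`n = 4, 8, 16`).  This file is the uniform proof.

THE MECHANISM (§1–§3), for ANY lattice `L ∋` all pairs, all biarc faces, all base changes of `[T₀]`, stable under base change:
1. **Telescoping** (`fplus_eq_V_sub`, `V_sub_V_add_mem`): `fplus p q = V(p,q) − V(p+1,q)` with `V(p,q) = [p,q] − [p,q−1]`, so
   `V(p,q) − V(p+m,q) ∈ L` for every `m`;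
2. **Half-turn** (`W_sub_W_mem`): at `m = n`, `barc (p+n) q' = (barc p (q'+n))·c` turns `V(p+n,q)` into `−V(p,q+n)` modulo pairs, whence
   `W(p,q) − W(p,q−1) ∈ L` for `W(p,q) = [p,q] + [p,q+n]`; descending `q` to `p` (`W_sub_W_sub_mem`) reaches the base block: `W(p,q) ∈ L`
   (`W_mem`);
3. **Order four** (`two_smul_single_barc_mem_of`): `barc p (q+n) = (barc p q)·h⁻¹` with `h = xa (p+q−n−1)`, `h² = c` (part I), so part Jʼs
   trick gives **`2·[barc p q] ∈ L`**.
§4 specialises to the target lattice `𝓣(S, T₀) = ℤ⟨pairs⟩ + ℤ⟨base changes of S⟩ + ℤ⟨base changes of [T₀]⟩` of the META-THEOREM for every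
finite `S` containing the `n` biarc faces `fplus k 0`, `k < n` (`two_pow_one_smul_single_barc_mem_target`): the biarc blocks — among them the two
residual blocks `E₊ ∋ T₀^{(a 0)} = barc 1 0` and `E₋ ∋ T₀^{(xa 0)} = barc 0 1` — reduce onto `ℤ[G]·[T₀]` with exponent `k = 1`.

## References
* [Pohlmann1968] H. Pohlmann, Algebraic cycles on abelian varieties of complex multiplication type, Ann. of Math. 88 (1968), Thm 1.
-/

namespace Summit.HodgeConjecture.CorCM.Census.QuaternionColumn

open Finset QuaternionGroup
open Summit.HodgeConjecture.CorCM.Prior.AllgGroup.RfwfAllgGroup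
open Summit.HodgeConjecture.CorCM.Census.BlockParity
open Summit.HodgeConjecture.CorCM.Census.Coinvariant
open Summit.HodgeConjecture.CorCM.Census.Nondegenerate
open Summit.HodgeConjecture.CorCM.Census.TwistGeneration

noncomputable section

variable {n : ℕ} [NeZero n]

/-! ## §0 Base change of the biarc face along a reflection: one orbit per residue `p − q (mod n)` -/

/-- A face relation is symmetric in its two places. [folklore] -/
theorem gface_comm (Φ : CMF (QuaternionGroup n) (c n)) (t t' : QuaternionGroup n) :
    gface (c n) c_mul_c Φ t t' = gface (c n) c_mul_c Φ t' t := by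
  rw [gface, gface, oflipCM_oflipCM_comm (c n) c_mul_c t t']
  abel

/-- A face relation only depends on the places: `gface Φ (c·t) (c·t') = gface Φ t t'`. [folklore] -/
theorem gface_cmul_cmul (Φ : CMF (QuaternionGroup n) (c n)) (t t' : QuaternionGroup n) :
    gface (c n) c_mul_c Φ (c n * t) (c n * t') = gface (c n) c_mul_c Φ t t' := by
  rw [gface, gface, oflipCM_cmul, oflipCM_cmul, oflipCM_cmul]

omit [NeZero n] in
/-- The inverse of a reflection: `(xa k)⁻¹ = xa (n + k)`. [folklore] -/
theorem inv_xa (k : ZMod (2 * n)) : (xa k : QuaternionGroup n)⁻¹ = xa ((n : ZMod (2 * n)) + k) := rfl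

/-- **Base change of the biarc face along a reflection**: `fplus p q · (xa k)⁻¹ = fplus (k − q + n + 1) (k − p + 1)` — so the difference
`p − q` changes by `n`: the `2n` faces `fplus p q` with `p − q` in a fixed class mod `n` form ONE `G`-orbit. [folklore] -/
theorem mapDomain_rt_xa_fplus (k p q : ZMod (2 * n)) :
    Finsupp.mapDomain (rt (c n) (xa k)) (fplus p q) = fplus (k - q + (n : ZMod (2 * n)) + 1) (k - p + 1) := by
  rw [fplus, mapDomain_rt_gface, rt_xa_barc, inv_xa, a_mul_xa, xa_mul_xa, fplus, gface_comm]
  have e1 : (a ((n : ZMod (2 * n)) + ((n : ZMod (2 * n)) + k) - (q - 1)) : QuaternionGroup n) =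
      c n * a (k - q + (n : ZMod (2 * n)) + 1) := by
    rw [(c_mul_a _).1]; congr 1; ring
  have e2 : (xa ((n : ZMod (2 * n)) + k - p) : QuaternionGroup n) = c n * xa (k - p + 1 - 1) := by
    rw [(c_mul_a _).2]; congr 1; ring
  rw [e1, e2, gface_cmul_cmul]

/-! ## §1 Telescoping along the rotation arc -/

/-- **The biarc face as a difference of vertical differences**: `fplus p q = V(p,q) − V(p+1,q)`, `V(p,q) = [p,q] − [p,q−1]`. [folklore] -/
theorem fplus_eq_V_sub (p q : ZMod (2 * n)) : fplus p q =
    (Finsupp.single (barc p q) (1 : ℤ) - Finsupp.single (barc p (q - 1)) 1) -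
      (Finsupp.single (barc (p + 1) q) (1 : ℤ) - Finsupp.single (barc (p + 1) (q - 1)) 1) := by
  rw [fplus_eq]; abel

section AnyLattice

variable (L : Submodule ℤ (CMF (QuaternionGroup n) (c n) →₀ ℤ))
  (hF : ∀ p q : ZMod (2 * n), fplus p q ∈ L)

include hF in
/-- **Telescoping**: `V(p,q) − V(p+m,q) ∈ L` for every `m`. [folklore] -/
theorem V_sub_V_add_mem (p q : ZMod (2 * n)) (m : ℕ) :
    (Finsupp.single (barc p q) (1 : ℤ) - Finsupp.single (barc p (q - 1)) 1) -
      (Finsupp.single (barc (p + (m : ZMod (2 * n))) q) (1 : ℤ) - Finsupp.single (barc (p + (m : ZMod (2 * n))) (q - 1)) 1) ∈ L := by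
  induction m with
  | zero => rw [Nat.cast_zero, add_zero, sub_self]; exact Submodule.zero_mem _
  | succ m ih =>
    have h := hF (p + (m : ZMod (2 * n))) q
    rw [fplus_eq_V_sub] at h
    have e : (Finsupp.single (barc p q) (1 : ℤ) - Finsupp.single (barc p (q - 1)) 1) -
        (Finsupp.single (barc (p + ((m + 1 : ℕ) : ZMod (2 * n))) q) (1 : ℤ) -
          Finsupp.single (barc (p + ((m + 1 : ℕ) : ZMod (2 * n))) (q - 1)) 1) =
        ((Finsupp.single (barc p q) (1 : ℤ) - Finsupp.single (barc p (q - 1)) 1) -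
          (Finsupp.single (barc (p + (m : ZMod (2 * n))) q) (1 : ℤ) - Finsupp.single (barc (p + (m : ZMod (2 * n))) (q - 1)) 1)) +
        ((Finsupp.single (barc (p + (m : ZMod (2 * n))) q) (1 : ℤ) - Finsupp.single (barc (p + (m : ZMod (2 * n))) (q - 1)) 1) -
          (Finsupp.single (barc (p + (m : ZMod (2 * n)) + 1) q) (1 : ℤ) - Finsupp.single (barc (p + (m : ZMod (2 * n)) + 1) (q - 1)) 1)) := by
      rw [Nat.cast_succ, ← add_assoc]; abel
    rw [e]
    exact Submodule.add_mem _ ih h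

/-! ## §2 The half-turn and the descent to the base block -/

variable (hP : ∀ Ψ : CMF (QuaternionGroup n) (c n), pair (c n) Ψ ∈ L)

/-- `[barc (p+n) q'] = pair (barc p (q'+n)) − [barc p (q'+n)]` (the complement of a biarc). [folklore] -/
theorem single_barc_add_n_left (p q' : ZMod (2 * n)) : Finsupp.single (barc (p + (n : ZMod (2 * n))) q') (1 : ℤ) =
    pair (c n) (barc p (q' + (n : ZMod (2 * n)))) - Finsupp.single (barc p (q' + (n : ZMod (2 * n)))) 1 := by
  rw [pair, rt_c_barc, add_assoc, two_n_eq_zero, add_zero, add_sub_cancel_left]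

include hF hP in
/-- **The half-turn step**: `W(p,q) − W(p,q−1) ∈ L`, where `W(p,q) = [p,q] + [p,q+n]`. [folklore] -/
theorem W_sub_W_mem (p q : ZMod (2 * n)) :
    (Finsupp.single (barc p q) (1 : ℤ) + Finsupp.single (barc p (q + (n : ZMod (2 * n)))) 1) -
      (Finsupp.single (barc p (q - 1)) (1 : ℤ) + Finsupp.single (barc p (q - 1 + (n : ZMod (2 * n)))) 1) ∈ L := by
  have h := V_sub_V_add_mem L hF p q n
  rw [single_barc_add_n_left, single_barc_add_n_left] at h
  have hp1 := hP (barc p (q + (n : ZMod (2 * n))))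
  have hp2 := hP (barc p (q - 1 + (n : ZMod (2 * n))))
  have e : (Finsupp.single (barc p q) (1 : ℤ) + Finsupp.single (barc p (q + (n : ZMod (2 * n)))) 1) -
      (Finsupp.single (barc p (q - 1)) (1 : ℤ) + Finsupp.single (barc p (q - 1 + (n : ZMod (2 * n)))) 1) =
      ((Finsupp.single (barc p q) (1 : ℤ) - Finsupp.single (barc p (q - 1)) 1) -
        ((pair (c n) (barc p (q + (n : ZMod (2 * n)))) - Finsupp.single (barc p (q + (n : ZMod (2 * n)))) 1) -
          (pair (c n) (barc p (q - 1 + (n : ZMod (2 * n)))) - Finsupp.single (barc p (q - 1 + (n : ZMod (2 * n)))) 1))) +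
        pair (c n) (barc p (q + (n : ZMod (2 * n)))) - pair (c n) (barc p (q - 1 + (n : ZMod (2 * n)))) := by abel
  rw [e]
  exact Submodule.sub_mem _ (Submodule.add_mem _ h hp1) hp2

include hF hP in
/-- **Descent**: `W(p,q) − W(p,q−m) ∈ L` for every `m`. [folklore] -/
theorem W_sub_W_sub_mem (p q : ZMod (2 * n)) (m : ℕ) :
    (Finsupp.single (barc p q) (1 : ℤ) + Finsupp.single (barc p (q + (n : ZMod (2 * n)))) 1) -
      (Finsupp.single (barc p (q - (m : ZMod (2 * n)))) (1 : ℤ) + Finsupp.single (barc p (q - (m : ZMod (2 * n)) + (n : ZMod (2 * n)))) 1) ∈ L := by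
  induction m with
  | zero => rw [Nat.cast_zero, sub_zero, sub_self]; exact Submodule.zero_mem _
  | succ m ih =>
    have h := W_sub_W_mem L hF hP p (q - (m : ZMod (2 * n)))
    have e : (Finsupp.single (barc p q) (1 : ℤ) + Finsupp.single (barc p (q + (n : ZMod (2 * n)))) 1) -
        (Finsupp.single (barc p (q - ((m + 1 : ℕ) : ZMod (2 * n)))) (1 : ℤ) +
          Finsupp.single (barc p (q - ((m + 1 : ℕ) : ZMod (2 * n)) + (n : ZMod (2 * n)))) 1) =
        ((Finsupp.single (barc p q) (1 : ℤ) + Finsupp.single (barc p (q + (n : ZMod (2 * n)))) 1) -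
          (Finsupp.single (barc p (q - (m : ZMod (2 * n)))) (1 : ℤ) + Finsupp.single (barc p (q - (m : ZMod (2 * n)) + (n : ZMod (2 * n)))) 1)) +
        ((Finsupp.single (barc p (q - (m : ZMod (2 * n)))) (1 : ℤ) + Finsupp.single (barc p (q - (m : ZMod (2 * n)) + (n : ZMod (2 * n)))) 1) -
          (Finsupp.single (barc p (q - (m : ZMod (2 * n)) - 1)) (1 : ℤ) + Finsupp.single (barc p (q - (m : ZMod (2 * n)) - 1 + (n : ZMod (2 * n)))) 1)) := by
      rw [Nat.cast_succ, ← sub_sub]; abel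
    rw [e]
    exact Submodule.add_mem _ ih h

variable (hB : ∀ Q : QuaternionGroup n, Finsupp.single (rt (c n) Q (barc 0 0)) (1 : ℤ) ∈ L)

/-- The diagonal biarcs are the rotation base changes of `T₀ = barc 0 0`: `barc p p = T₀ · (a (−p))⁻¹`. [folklore] -/
theorem barc_self_eq_rt (p : ZMod (2 * n)) : barc p p = rt (c n) (a (-p)) (barc 0 0) := by
  rw [rt_a_barc, zero_sub, neg_neg]

/-- … and their half-turn partners are base changes of `T₀` too: `barc p (p+n) = T₀ · (a (−p) · xa (p+p−n−1))⁻¹`. [folklore] -/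
theorem barc_self_add_n_eq_rt (p : ZMod (2 * n)) :
    barc p (p + (n : ZMod (2 * n))) = rt (c n) (xa (p + p - (n : ZMod (2 * n)) - 1) * a (-p)) (barc 0 0) := by
  rw [rt_mul, ← barc_self_eq_rt, ← barc_add_n_eq_rt]

include hF hP hB in
/-- **`W(p,q) = [p,q] + [p,q+n] ∈ L`** for all `p q` (descend `q` to `p`, where both biarcs are base changes of `T₀`). [folklore] -/
theorem W_mem (p q : ZMod (2 * n)) :
    Finsupp.single (barc p q) (1 : ℤ) + Finsupp.single (barc p (q + (n : ZMod (2 * n)))) 1 ∈ L := by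
  have h := W_sub_W_sub_mem L hF hP p q (q - p).val
  rw [ZMod.natCast_zmod_val, sub_sub_cancel] at h
  have h1 : Finsupp.single (barc p p) (1 : ℤ) ∈ L := by rw [barc_self_eq_rt]; exact hB _
  have h2 : Finsupp.single (barc p (p + (n : ZMod (2 * n)))) (1 : ℤ) ∈ L := by rw [barc_self_add_n_eq_rt]; exact hB _
  have e : Finsupp.single (barc p q) (1 : ℤ) + Finsupp.single (barc p (q + (n : ZMod (2 * n)))) 1 =
      ((Finsupp.single (barc p q) (1 : ℤ) + Finsupp.single (barc p (q + (n : ZMod (2 * n)))) 1) -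
        (Finsupp.single (barc p p) (1 : ℤ) + Finsupp.single (barc p (p + (n : ZMod (2 * n)))) 1)) +
        (Finsupp.single (barc p p) (1 : ℤ) + Finsupp.single (barc p (p + (n : ZMod (2 * n)))) 1) := by abel
  rw [e]
  exact Submodule.add_mem _ h (Submodule.add_mem _ h1 h2)

include hF hP hB in
/-- `W(p,q)` in the order-four shape: `[Ψ] + [Ψ·h⁻¹] ∈ L` with `Ψ = barc p q`, `h = xa (p+q−n−1)`, `h² = c`. [folklore] -/
theorem single_add_single_rt_mem (p q : ZMod (2 * n)) :
    Finsupp.single (barc p q) (1 : ℤ) + Finsupp.single (rt (c n) (xa (p + q - (n : ZMod (2 * n)) - 1)) (barc p q)) 1 ∈ L := by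
  rw [← barc_add_n_eq_rt]; exact W_mem L hF hP hB p q

end AnyLattice

/-! ## §3–§4 The order-four closing in the target lattice of the META-THEOREM -/

/-- **Every biarc face is a base change of one of the `n` faces `fplus k 0`, `k < n`**: a finite family `S` containing them has every
`fplus p q` in `ℤ⟨base changes of S⟩` (hence in the target lattice). [folklore] -/
theorem fplus_mem_target (S : Finset (CMF (QuaternionGroup n) (c n) →₀ ℤ)) (hS : ∀ k : ℕ, k < n → fplus (k : ZMod (2 * n)) 0 ∈ S)
    (p q : ZMod (2 * n)) :
    fplus p q ∈ (Submodule.span ℤ (pairSet (c n)) ⊔ Submodule.span ℤ (translates (c n) S)) ⊔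
      Submodule.span ℤ (Set.range fun Q : QuaternionGroup n => Finsupp.single (rt (c n) Q (barc 0 0)) (1 : ℤ)) := by
  by_cases hs : (p - q).val < n
  · have h := mapDomain_rt_mem_target_of_mem (c n) S (barc 0 0) (a (-q)) (hS (p - q).val hs)
    rwa [ZMod.natCast_zmod_val, mapDomain_rt_a_fplus, show p - q - -q = p by ring, show (0 : ZMod (2 * n)) - -q = q by ring] at h
  · have hs' : (p - q + (n : ZMod (2 * n))).val < n := by
      have h := lt_iff_not_lt_add_n (p - q); tauto
    have h := mapDomain_rt_mem_target_of_mem (c n) S (barc 0 0) (xa (p - (n : ZMod (2 * n)) - 1)) (hS _ hs')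
    rwa [ZMod.natCast_zmod_val, mapDomain_rt_xa_fplus, show p - (n : ZMod (2 * n)) - 1 - 0 + (n : ZMod (2 * n)) + 1 = p by ring,
      show p - (n : ZMod (2 * n)) - 1 - (p - q + (n : ZMod (2 * n))) + 1 = q by
        linear_combination (-1 : ZMod (2 * n)) * two_n_eq_zero (n := n)] at h

/-- **THE BIARC CIRCLE CLOSES WITH EXPONENT ONE.**  For every finite family `S` of vectors containing the `n` biarc faces `fplus k 0`
(`k < n`), and every biarc: `2·[barc p q] ∈ ℤ⟨pairs⟩ + ℤ⟨base changes of S⟩ + ℤ⟨base changes of [T₀]⟩`, `T₀ = barc 0 0`. [folklore] -/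
theorem two_smul_single_barc_mem_target (S : Finset (CMF (QuaternionGroup n) (c n) →₀ ℤ))
    (hS : ∀ k : ℕ, k < n → fplus (k : ZMod (2 * n)) 0 ∈ S) (p q : ZMod (2 * n)) :
    (2 : ℤ) • Finsupp.single (barc p q) (1 : ℤ) ∈ (Submodule.span ℤ (pairSet (c n)) ⊔ Submodule.span ℤ (translates (c n) S)) ⊔
      Submodule.span ℤ (Set.range fun Q : QuaternionGroup n => Finsupp.single (rt (c n) Q (barc 0 0)) (1 : ℤ)) := by
  have h := two_mul_smul_single_mem_of_smul_add_mem (c n) S (barc 0 0) c_comm (xa (p + q - (n : ZMod (2 * n)) - 1))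
    (xa_mul_xa_self _) 1 (barc p q) (by
      rw [one_smul]
      exact single_add_single_rt_mem _ (fplus_mem_target S hS) (pair_mem_target (c n) S (barc 0 0))
        (single_rt_mem_target (c n) S (barc 0 0)) p q)
  rwa [mul_one] at h

/-- The same with the exponent written as `2^1` (the shape of the residual hypothesis `hres` of
`Splitting.isLeast_card_gfaces_generate_of_residual_reduction`). [folklore] -/
theorem two_pow_one_smul_single_barc_mem_target (S : Finset (CMF (QuaternionGroup n) (c n) →₀ ℤ))
    (hS : ∀ k : ℕ, k < n → fplus (k : ZMod (2 * n)) 0 ∈ S) (p q : ZMod (2 * n)) :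
    ((2 : ℤ) ^ 1) • Finsupp.single (barc p q) (1 : ℤ) ∈ (Submodule.span ℤ (pairSet (c n)) ⊔ Submodule.span ℤ (translates (c n) S)) ⊔
      Submodule.span ℤ (Set.range fun Q : QuaternionGroup n => Finsupp.single (rt (c n) Q (barc 0 0)) (1 : ℤ)) := by
  rw [pow_one]; exact two_smul_single_barc_mem_target S hS p q

/-- **Base changes of biarcs reduce too** (`2·[barc p q · Q⁻¹] ∈ 𝓣`; of course `barc p q · Q⁻¹` is again a biarc, part I). [folklore] -/
theorem two_smul_single_rt_barc_mem_target (S : Finset (CMF (QuaternionGroup n) (c n) →₀ ℤ))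
    (hS : ∀ k : ℕ, k < n → fplus (k : ZMod (2 * n)) 0 ∈ S) (Q : QuaternionGroup n) (p q : ZMod (2 * n)) :
    (2 : ℤ) • Finsupp.single (rt (c n) Q (barc p q)) (1 : ℤ) ∈
      (Submodule.span ℤ (pairSet (c n)) ⊔ Submodule.span ℤ (translates (c n) S)) ⊔
        Submodule.span ℤ (Set.range fun Q : QuaternionGroup n => Finsupp.single (rt (c n) Q (barc 0 0)) (1 : ℤ)) :=
  smul_single_rt_mem_target (c n) S (barc 0 0) c_comm Q 2 (two_smul_single_barc_mem_target S hS p q)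

end

end Summit.HodgeConjecture.CorCM.Census.QuaternionColumn
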